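import Literature.Computability.AlgebraicComplexity.LinSubst
import Mathlib.RingTheory.MvPolynomial.WeightedHomogeneous
import Mathlib.LinearAlgebra.Vandermonde
import Mathlib.LinearAlgebra.Matrix.NonsingularInverse

/-!
# Candidate proof (refuter drefute gen 2, evidence only) of `stub_interp` of line `toric-face-debordering`
(crux stmt-ValiantsHypothesis-5778): interpolation of weighted-homogeneous components by torus substitutes.
-/

open MvPolynomial
open scoped BigOperators

namespace DrefuteG2.Interp

open Literature.Computability.AlgebraicComplexity

variable {σ : Type} [Fintype σ] [DecidableEq σ]

/-- A diagonal substitution scales a monomial: `x^α ↦ (∏ dᵢ^{αᵢ}) x^α`. -/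
theorem linSubst_diagonal_monomial (d : σ → ℂ) (α : σ →₀ ℕ) (a : ℂ) :
    linSubst σ ℂ (Matrix.diagonal d) (monomial α a) =
      (∏ i ∈ α.support, d i ^ α i) • monomial α a := by
  have hg : (fun i => ∑ j, Matrix.diagonal d j i • (X j : MvPolynomial σ ℂ)) = fun i => d i • X i := by
    funext i
    rw [Finset.sum_eq_single i]
    · rw [Matrix.diagonal_apply_eq]
    · intro j _ hji
      rw [Matrix.diagonal_apply_ne _ hji, zero_smul]
    · intro h
      exact absurd (Finset.mem_univ i) h
  simp only [linSubst, hg, aeval_monomial, algebraMap_eq]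
  rw [Finsupp.prod, monomial_eq, Finsupp.prod]
  simp only [smul_eq_C_mul, mul_pow, ← map_pow]
  rw [Finset.prod_mul_distrib, ← map_prod]
  ring

/-- With `dᵢ = s^{wᵢ}` the scaling factor is `s^{weight w α}`. -/
theorem linSubst_torus_monomial (w : σ → ℕ) (s : ℂ) (α : σ →₀ ℕ) (a : ℂ) :
    linSubst σ ℂ (Matrix.diagonal fun i => s ^ (w i)) (monomial α a) =
      s ^ (Finsupp.weight w α) • monomial α a := by
  rw [linSubst_diagonal_monomial]
  congr 1
  simp_rw [← pow_mul]
  rw [Finset.prod_pow_eq_pow_sum, Finsupp.weight_apply, Finsupp.sum]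
  congr 1
  refine Finset.sum_congr rfl fun i _ => ?_
  rw [smul_eq_mul, mul_comm]

/-- The torus substitute `f(s^w x)` is the generating polynomial of the weighted components:
`Σ_{v ≤ N} s^v · wHC_w^v f` when all weights on the support are `≤ N`. -/
theorem linSubst_torus_eq_sum (w : σ → ℕ) (N : ℕ) (f : MvPolynomial σ ℂ)
    (hf : ∀ d ∈ f.support, Finsupp.weight w d ≤ N) (s : ℂ) :
    linSubst σ ℂ (Matrix.diagonal fun i => s ^ (w i)) f =
      ∑ v ∈ Finset.range (N + 1), s ^ v • weightedHomogeneousComponent w v f := by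
  classical
  conv_lhs => rw [f.as_sum]
  rw [map_sum]
  simp_rw [linSubst_torus_monomial, weightedHomogeneousComponent_apply, Finset.smul_sum]
  have hmaps : ∀ d ∈ f.support, (fun d => Finsupp.weight w d) d ∈ Finset.range (N + 1) := fun d hd =>
    Finset.mem_range.2 (Nat.lt_succ_of_le (hf d hd))
  rw [← Finset.sum_fiberwise_of_maps_to hmaps]
  refine Finset.sum_congr rfl fun v _ => Finset.sum_congr rfl fun d hd => ?_
  rw [(Finset.mem_filter.1 hd).2]

/-- **`stub_interp`** (candidate proof): Vandermonde interpolation at the nodes `1, …, N+1`. -/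
theorem stub_interp : ∀ (σ : Type) [Fintype σ] [DecidableEq σ] (w : σ → ℕ) (N e : ℕ) (f : MvPolynomial σ ℂ),
    (∀ d ∈ f.support, Finsupp.weight w d ≤ N) →
      ∃ c : Fin (N + 1) → ℂ,
        MvPolynomial.weightedHomogeneousComponent w e f =
          ∑ j : Fin (N + 1), c j • linSubst σ ℂ (Matrix.diagonal fun i => (((j : ℕ) : ℂ) + 1) ^ (w i)) f := by
  intro σ _ _ w N e f hf
  classical
  -- components `F v`, substitutes `T j = Σ_v V j v • F v` with the Vandermonde matrix at the nodes `j+1`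
  set F : Fin (N + 1) → MvPolynomial σ ℂ := fun v => weightedHomogeneousComponent w (v : ℕ) f with hF
  set a : Fin (N + 1) → ℂ := fun j => ((j : ℕ) : ℂ) + 1 with ha
  set V : Matrix (Fin (N + 1)) (Fin (N + 1)) ℂ := Matrix.vandermonde a with hV
  have hT : ∀ j : Fin (N + 1),
      linSubst σ ℂ (Matrix.diagonal fun i => (((j : ℕ) : ℂ) + 1) ^ (w i)) f = ∑ v : Fin (N + 1), V j v • F v := by
    intro j
    rw [linSubst_torus_eq_sum w N f hf, Finset.sum_range (fun v => (((j : ℕ) : ℂ) + 1) ^ v • weightedHomogeneousComponent w v f)]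
    refine Finset.sum_congr rfl fun v _ => ?_
    rw [hV, Matrix.vandermonde_apply]
  -- the Vandermonde matrix is invertible
  have hinj : Function.Injective a := by
    intro i j h
    rw [ha] at h
    have : ((i : ℕ) : ℂ) = ((j : ℕ) : ℂ) := add_right_cancel h
    exact Fin.ext (by exact_mod_cast this)
  have hdet : IsUnit V.det := by
    rw [isUnit_iff_ne_zero, hV]
    exact Matrix.det_vandermonde_ne_zero_iff.2 hinj
  by_cases he : e ≤ N
  · -- `e ≤ N`: use row `e` of `V⁻¹`
    refine ⟨fun j => V⁻¹ ⟨e, Nat.lt_succ_of_le he⟩ j, ?_⟩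
    simp_rw [hT, Finset.smul_sum, smul_smul]
    rw [Finset.sum_comm]
    have key : ∀ v : Fin (N + 1), (∑ j : Fin (N + 1), (V⁻¹ ⟨e, Nat.lt_succ_of_le he⟩ j * V j v)) =
        (1 : Matrix (Fin (N + 1)) (Fin (N + 1)) ℂ) ⟨e, Nat.lt_succ_of_le he⟩ v := by
      intro v
      rw [← Matrix.nonsing_inv_mul V hdet, Matrix.mul_apply]
    simp_rw [← Finset.sum_smul, key, Matrix.one_apply, ite_smul, one_smul, zero_smul,
      Finset.sum_ite_eq, Finset.mem_univ, if_true]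
    rfl
  · -- `e > N`: the component vanishes
    refine ⟨fun _ => 0, ?_⟩
    simp only [zero_smul, Finset.sum_const_zero]
    refine weightedHomogeneousComponent_eq_zero' e f fun d hd => ?_
    have := hf d hd
    omega

end DrefuteG2.Interp
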